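import Mathlib
import Summits.RiemannHypothesis.Statement
import Literature.NumberTheory.DiophantineGeometry.NamedHypothesesRHProofs
import Literature.NumberTheory.LFunctions.RHWave0
import Literature.NumberTheory.LFunctions.RiemannHypothesisUpTo101
import Literature.NumberTheory.LFunctions.ZetaZerosProofs
import Literature.NumberTheory.LFunctions.ZeroDensityInghamHuxley
import Literature.NumberTheory.LFunctions.ZeroCounting
import Summits.RiemannHypothesis.RiemannHypothesis.Theorems.DBNDbnHighUniformDetectsRH
import Summits.RiemannHypothesis.RiemannHypothesis.Theorems.DeBrangesChainConverse
import Literature.NumberTheory.LFunctions.SelbergArgOmegaProofs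
import Literature.Barriers.RiemannHypothesis.BoundedFluctuationCounting
import Literature.Barriers.RiemannHypothesis.GramRosserFailuresHolds
import Literature.NumberTheory.LFunctions.EquivalentsHolds
import Literature.NumberTheory.LFunctions.KiKimLeeProofs
import Literature.NumberTheory.LFunctions.DeBruijnNewmanConstProofs
import Literature.Barriers.RiemannHypothesis.NewmanConjecture
import Summits.RiemannHypothesis.RiemannHypothesis.Theorems.DBNDbnThesis
import Summits.RiemannHypothesis.RiemannHypothesis.Theorems.DBNUniformFarZerosReal
import Summits.RiemannHypothesis.RiemannHypothesis.Theorems.DBNNoCoalescenceDoor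
import Summits.RiemannHypothesis.RiemannHypothesis.Theorems.PfPersistenceDilatingLandau
import Literature.NumberTheory.LFunctions.ZetaRealAxis
import Literature.NumberTheory.LFunctions.GeneralizedRH
import Summits.RiemannHypothesis.RiemannHypothesis.Theorems.DBNCoalescenceAtLambda
import Literature.NumberTheory.LFunctions.DeBruijnHSimpleZerosProofs
import HarnessLib

/-!
# Costume detectors II (HEIGHT tails: ZD, DBR, DBN, and the CONDITIONAL(F1) forms) — cell `rh-split`

HONEST LABEL: «SPLITTING SEARCH over kernel-typed RH-EQUIVALENCES; a splitting A ∧ B ⟹ RH is CONDITIONAL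
bookkeeping unless A and B are both proved; nothing here bears on the truth of RH.»

Companion of `CostumeDetectors.lean` (index tails), same reading: NEGATIVE KNOWLEDGE for future planners (brief
`RH-SPLITTING-BRIEF.md` sha16 f79c5f09d8bcb036; referee protocol §1 «tail lemma»).  The HEIGHT tail «every zero of
`ζ` with `Im s > H` is on the line» is RH by itself at the KERNEL height `H = 101` (`riemannHypothesisUpTo_hundredOne`,
no numerical-RH fact), hence every «bridge» `C ⟹ TAIL_zd(101)` is `C ⟹ RH` in costume, and every height tail already
implies the Density Hypothesis (`densityHypothesis_of_zdTail`: density-type conjectures sit BELOW every height tail —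
the zd barrier in Lean terms).  DBR: the index-free conjunction on Suzuki's `V(0)`.  DBN: the high-uniform crux IS the
height tail at `3·10¹²`.  The LAST section collects the detectors that need the Platt–Trudgian named fact
`platt_trudgian_numerical_rh` («F1», RH to height 3 000 175 332 800, NOT discharged), each stated as `F1 → (TAIL ↔ RH)`:
nobody should quote those tails as RH-equivalent unconditionally.  Raw quantified forms only (no `def`).  Typed by
rh-split-typer-2 (zd/weil/dbn/dbr), merged and filed by rh-split-typer-1, refereed by rh-split-ref.  Inside this
namespace the bare token `RiemannHypothesis` is `Summit.RiemannHypothesis`; Mathlib's is `_root_.RiemannHypothesis`.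
-/

noncomputable section

-- D-0017: `Summit.<S>.<S>.…` is the designed namespace of a single-problem summit.
set_option linter.dupNamespace false

namespace Summit.RiemannHypothesis.RiemannHypothesis.Theorems.Splittings.CostumeDetectorsHeight

open Filter Polynomial
open Literature.NumberTheory.LFunctions Literature.NumberTheory.DiophantineGeometry
open Summit.RiemannHypothesis.RiemannHypothesis.Theorems

/-! ## §1 ZD — height tails (`RH ⟺ ∀ T, RiemannHypothesisUpTo T`, `riemannHypothesis_iff_forall_riemannHypothesisUpTo_holds`); F1-free at the KERNEL height `101` -/

/-- zd bookkeeping, every `H`: RH up to `H` and the raw tail above `H` give RH (brief rh-split zd; via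
`riemannHypothesis_of_forall_riemannHypothesisUpTo_holds`). [folklore] -/
theorem rh_of_rhUpTo_zdTail (H : ℝ) (hF : RiemannHypothesisUpTo H)
    (hT : ∀ s : ℂ, riemannZeta s = 0 → 0 < s.im → H < s.im → s.re = 1 / 2) : _root_.RiemannHypothesis :=
  riemannHypothesis_of_forall_riemannHypothesisUpTo_holds fun T s hs h0 _ ↦ by
    by_cases hH : s.im ≤ H
    · exact hF s hs h0 hH
    · exact hT s hs h0 (lt_of_not_ge hH)

/-- The raw zd tail is RH-implied, every `H`. [folklore] -/
theorem zdTail_of_rh (H : ℝ) (h : _root_.RiemannHypothesis) :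
    ∀ s : ℂ, riemannZeta s = 0 → 0 < s.im → H < s.im → s.re = 1 / 2 :=
  fun s hs h0 _ ↦ RiemannHypothesisUpTo.of_riemannHypothesis h s.im s hs h0 le_rfl

/-- costume detector / RH-EQUIVALENT tail, F1-free (FIN(101) = tree theorem `riemannHypothesisUpTo_hundredOne`,
std axioms); brief rh-split zd. [folklore] -/
theorem rh_of_zdTail101 (h : ∀ s : ℂ, riemannZeta s = 0 → 0 < s.im → 101 < s.im → s.re = 1 / 2) :
    _root_.RiemannHypothesis :=
  rh_of_rhUpTo_zdTail 101 riemannHypothesisUpTo_hundredOne h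

/-- costume detector / RH-EQUIVALENT tail, F1-free; brief rh-split zd. [folklore] -/
theorem zdTail101_iff_rh :
    (∀ s : ℂ, riemannZeta s = 0 → 0 < s.im → 101 < s.im → s.re = 1 / 2) ↔ _root_.RiemannHypothesis :=
  ⟨rh_of_zdTail101, zdTail_of_rh 101⟩

/-- costume detector, F1-free: a bridge `C ⟹ TAIL_zd(101)` IS `C ⟹ RH`; brief rh-split zd. [folklore] -/
theorem zdBridge_iff (C : Prop) :
    (C → ∀ s : ℂ, riemannZeta s = 0 → 0 < s.im → 101 < s.im → s.re = 1 / 2) ↔ (C → _root_.RiemannHypothesis) :=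
  ⟨fun h hC ↦ rh_of_zdTail101 (h hC), fun h hC ↦ zdTail_of_rh 101 (h hC)⟩

/-- costume detector, F1-free: for an RH-IMPLIED `C`, `C ⟹ TAIL_zd(101)` IS `C ⟺ RH`; brief rh-split zd. [folklore] -/
theorem zdBridge_collapse (C : Prop) (hC : _root_.RiemannHypothesis → C) :
    (C → ∀ s : ℂ, riemannZeta s = 0 → 0 < s.im → 101 < s.im → s.re = 1 / 2) ↔ (C ↔ _root_.RiemannHypothesis) :=
  ⟨fun h ↦ ⟨fun c ↦ rh_of_zdTail101 (h c), hC⟩, fun h c ↦ zdTail_of_rh 101 (h.1 c)⟩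

/-- costume detector, F1-free: «distinct zeros above height 101 have distinct ordinates» is RH (an off-line
zero `s` has the companion `1 − conj s` at the same ordinate: functional equation + conjugation); brief rh-split zd.
[cite: Titchmarsh1986, §2.12] -/
theorem rh_of_ordinateInjective101
    (h : ∀ s s' : ℂ, riemannZeta s = 0 → riemannZeta s' = 0 → 0 < s.im → 101 < s.im → s.im = s'.im → s = s') :
    _root_.RiemannHypothesis := by
  refine rh_of_zdTail101 fun s hs h0 hH ↦ ?_
  obtain ⟨hre0, hre1⟩ := re_mem_Ioo_of_riemannZeta_eq_zero_of_im_ne_zero hs h0.ne'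
  have h1 : riemannZeta (1 - (starRingEnd ℂ) s) = 0 := by
    have hc : riemannZeta ((starRingEnd ℂ) s) = 0 := by rw [riemannZeta_conj, hs, map_zero]
    exact GeneralizedRH.riemannZeta_one_sub_eq_zero hc (by simpa using hre0) (by simpa using hre1)
  have heq := h s (1 - (starRingEnd ℂ) s) hs h1 h0 hH (by simp)
  have hre : s.re = (1 - (starRingEnd ℂ) s).re := by rw [← heq]
  simp at hre
  linarith

/-- zd barrier in Lean terms, F1-free: the raw tail above ANY height implies the Density Hypothesis (for
`σ > 1/2`, `N(σ,T) ≤ N(σ,H) = O(1)`; at `σ = 1/2` unconditionally `N ≪ T log T`) — every density-type conjecture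
sits below every height tail; brief rh-split zd. [cite: IwaniecKowalski2004, §10.5] -/
theorem densityHypothesis_of_zdTail (H : ℝ)
    (hT : ∀ s : ℂ, riemannZeta s = 0 → 0 < s.im → H < s.im → s.re = 1 / 2) : DensityHypothesis := by
  intro ε hε σ hσ hσ1
  rcases hσ.eq_or_lt with rfl | hlt
  · rw [show (2 : ℝ) * (1 - 1 / 2) + ε = 1 + ε by ring]
    exact (isBigO_zetaZeroCountRe_mul_log (by norm_num)).trans (isBigO_mul_log_rpow hε)
  · have hsub : ∀ T : ℝ, zetaZeroBox σ T ⊆ zetaZeroBox σ H := by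
      rintro T ρ ⟨h0, h1, h2, h3, h4⟩
      refine ⟨h0, h1, h2, h3, ?_⟩
      by_contra hHρ
      have := hT ρ h0 h3 (lt_of_not_ge hHρ)
      linarith
    refine Asymptotics.IsBigO.of_bound (zetaZeroCountRe σ H : ℝ) ?_
    filter_upwards [Filter.eventually_ge_atTop (1 : ℝ)] with T hT1
    rw [Real.norm_of_nonneg (Nat.cast_nonneg _), Real.norm_of_nonneg (Real.rpow_nonneg (by linarith) _)]
    have hle : (zetaZeroCountRe σ T : ℝ) ≤ zetaZeroCountRe σ H := by
      exact_mod_cast zetaZeroCountRe_le_of_subset (hsub T)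
    have hpow : (1 : ℝ) ≤ T ^ (2 * (1 - σ) + ε) := Real.one_le_rpow hT1 (by nlinarith)
    calc (zetaZeroCountRe σ T : ℝ) ≤ zetaZeroCountRe σ H := hle
      _ = (zetaZeroCountRe σ H : ℝ) * 1 := by ring
      _ ≤ (zetaZeroCountRe σ H : ℝ) * T ^ (2 * (1 - σ) + ε) :=
          mul_le_mul_of_nonneg_left hpow (Nat.cast_nonneg _)

/-! ## §2 DBR — index-free `(1) ∧ (2)` on Suzuki's `V(0)` (`DeBrangesChain.riemannHypothesis_iff_isolatedV0`) -/

/-- dbr bookkeeping (no height index): Suzuki's norm identity (1) and zero separation (2) on `V(0)` give RH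
(`DeBrangesChain.riemannHypothesis_iff_isolatedV0`, hypothesis-free); both conjuncts RH-implied, neither known
RH-equivalent alone; brief rh-split dbr. [cite: Suzuki2025WeilHilbertSpace, CJM Prop. 5.8 p. 17] -/
theorem rh_iff_normIdentity_and_separation :
    _root_.RiemannHypothesis ↔ WeilNormIdentityOn (suzukiV 0) ∧ ZeroSeparationOn (suzukiV 0) :=
  DeBrangesChain.riemannHypothesis_iff_isolatedV0.trans DeBrangesChain.isolatedV0_iff

/-! ## §3 DBN — the high-uniform crux is the zd tail at `3·10¹²` (F1-free forms) -/

/-- dbn, F1-free: the crux `DbnHighUniform` gives the raw zd tail above height `3·10¹²`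
(`DbnTheory.re_eq_one_half_of_dbnHighUniform`); brief rh-split dbn. [folklore] -/
theorem zdTail3e12_of_dbnHighUniform (h : Theses.DBN.DbnHighUniform) :
    ∀ s : ℂ, riemannZeta s = 0 → 0 < s.im → 3000000000000 < s.im → s.re = 1 / 2 :=
  fun _ hs h0 hH ↦ DbnTheory.re_eq_one_half_of_dbnHighUniform h hs (by rwa [abs_of_pos h0])

/-- dbn bookkeeping, F1-free: RH up to `3·10¹²` (ANY certificate) and `DbnHighUniform` give RH; brief rh-split dbn.
[folklore] -/
theorem rh_of_rhUpTo3e12_dbnHighUniform (hF : RiemannHypothesisUpTo 3000000000000)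
    (h : Theses.DBN.DbnHighUniform) : _root_.RiemannHypothesis :=
  rh_of_rhUpTo_zdTail _ hF (zdTail3e12_of_dbnHighUniform h)

/-- dbn costume detector, F1-free (dbn-bridge card's `rh_above_of_dbnTail_bridge`): a bridge `C ⟹ DbnHighUniform` is a
proof from `C` of RH above height `3·10¹²`; brief rh-split dbn. [folklore] -/
theorem rhAbove3e12_of_dbnTailBridge (C : Prop)
    (hb : C → ∀ t : ℝ, 0 < t → ∀ z : ℂ, deBruijnH t z = 0 → 6000000000000 ≤ |z.re| → z.im = 0) (hC : C) :
    ∀ s : ℂ, riemannZeta s = 0 → 3000000000000 < |s.im| → s.re = 1 / 2 :=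
  fun _ hs him ↦ DbnTheory.re_eq_one_half_of_dbnHighUniform (hb hC) hs him

/-! ## §4 CONDITIONAL(F1) — detectors that need the Platt–Trudgian named fact `platt_trudgian_numerical_rh` (RH to height 3 000 175 332 800; NOT discharged). Read each as `F1 → (TAIL ↔ RH)`; nobody should quote these tails as RH-equivalent unconditionally. -/

/-- CONDITIONAL(F1) costume detector: given F1, the raw zd tail above the Platt–Trudgian height IS RH; brief
rh-split zd. [cite: PlattTrudgianBLMS2021, Thm. 1] -/
theorem zdTailPT_iff_rh_of_plattTrudgian (h₁ : platt_trudgian_numerical_rh) :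
    (∀ s : ℂ, riemannZeta s = 0 → 0 < s.im → 3000175332800 < s.im → s.re = 1 / 2) ↔ _root_.RiemannHypothesis :=
  ⟨rh_of_rhUpTo_zdTail _ (fun s hs h0 hle ↦ h₁ s hs h0 hle), zdTail_of_rh _⟩

/-- CONDITIONAL(F1) costume detector: given F1, `C ⟹ TAIL_zd(H₀)` IS `C ⟹ RH`; brief rh-split zd.
[cite: PlattTrudgianBLMS2021, Thm. 1] -/
theorem zdBridgePT_iff_of_plattTrudgian (h₁ : platt_trudgian_numerical_rh) (C : Prop) :
    (C → ∀ s : ℂ, riemannZeta s = 0 → 0 < s.im → 3000175332800 < s.im → s.re = 1 / 2) ↔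
      (C → _root_.RiemannHypothesis) :=
  ⟨fun h c ↦ (zdTailPT_iff_rh_of_plattTrudgian h₁).1 (h c), fun h c ↦ zdTail_of_rh _ (h c)⟩

/-- CONDITIONAL(F1) costume detector: given F1, the dbn crux `DbnHighUniform` IS RH
(tree: `DbnTheory.riemannHypothesis_iff_dbnHighUniform`); brief rh-split dbn. [cite: PlattTrudgianBLMS2021, Thm. 1] -/
theorem dbnHighUniform_iff_rh_of_plattTrudgian (h₁ : platt_trudgian_numerical_rh) :
    Theses.DBN.DbnHighUniform ↔ _root_.RiemannHypothesis :=
  (DbnTheory.riemannHypothesis_iff_dbnHighUniform h₁).symm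

/-! ## §5 ZD-NEG — refuted height-indexed tails (argument / remainder / Rosser) and the jump principle (typed by rh-split-zd-neg, checked by typer-2) -/

section ZdNeg
open Filter Literature.NumberTheory.DiophantineGeometry Literature.NumberTheory.LFunctions
open Literature.Barriers.RiemannHypothesis

/-- N7: `|S(T)| < c` beyond `H` is FALSE for every `H, c` (Selberg Ω±, tree theorem, std axioms). [folklore] -/
theorem not_tailArgBound (H c : ℝ) : ¬ ∀ T : ℝ, H ≤ T → |zetaArgS T| < c := by
  intro h
  obtain ⟨t, ht, hlt⟩ := Selberg1946_zetaArgS_omega_holds.unbounded_above c H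
  have := (abs_lt.1 (h t ht)).2
  linarith

/-- N9: one-sided `S(T) < c` beyond `H` is FALSE. [folklore] -/
theorem not_tailArg_upper (H c : ℝ) : ¬ ∀ T : ℝ, H ≤ T → zetaArgS T < c := by
  intro h
  obtain ⟨t, ht, hlt⟩ := Selberg1946_zetaArgS_omega_holds.unbounded_above c H
  exact lt_irrefl _ ((h t ht).trans hlt)

/-- N8: one-sided `−c < S(T)` beyond `H` (Rosser/Gram shape) is FALSE. [folklore] -/
theorem not_tailArg_lower (H c : ℝ) : ¬ ∀ T : ℝ, H ≤ T → -c < zetaArgS T := by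
  intro h
  obtain ⟨t, ht, hlt⟩ := Selberg1946_zetaArgS_omega_holds.unbounded_below (-c) H
  exact lt_irrefl _ ((h t ht).trans hlt)

/-- N10: bounded remainder `|N(T) − W(T)| ≤ B` eventually is FALSE for every `B` (barrier
`BoundedFluctuationCounting_holds` applied to `N := N_ζ`). [folklore] -/
theorem not_boundedRemainder (B : ℝ) :
    ¬ ∀ᶠ T in atTop, |(zetaZeroCount T : ℝ) - rvmSmoothCount T| ≤ B := by
  intro h
  obtain ⟨T, hT⟩ := ((BoundedFluctuationCounting_holds.of_abs_sub_le h).1).exists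
  exact lt_irrefl _ hT

/-- N11: the weak Rosser rule in every Gram block beyond `T₀` is FALSE for every `T₀`. [folklore] -/
theorem not_rosserTail (T₀ : ℝ) :
    ¬ ∀ (n l : ℕ) (g : ℕ → ℝ), IsGramBlock n l g → T₀ ≤ g n → WeakRosserRule n l g :=
  fun h ↦ TrudgianGram2011_thm7_3_holds ⟨T₀, h⟩

/-- Hence the N7 splitting `FIN ∧ (|S| < 1 beyond H₀) ⟹ RH` holds VACUOUSLY (valid, moot). [folklore] -/
theorem rh_of_fin_of_tailArgBound (H₀ : ℝ) :
    RiemannHypothesisUpTo H₀ ∧ (∀ T : ℝ, H₀ ≤ T → |zetaArgS T| < 1) → _root_.RiemannHypothesis :=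
  fun h ↦ absurd h.2 (not_tailArgBound H₀ 1)

end ZdNeg

/-! ## §6 DBN-BRIDGE — bridge collapse for `DbnHighUniform` (typed by rh-split-dbn-bridge, checked by typer-2) -/

section DbnBridge
open Literature.NumberTheory.DiophantineGeometry Literature.NumberTheory.LFunctions
open Summit.RiemannHypothesis.RiemannHypothesis.Theorems
open Summit.RiemannHypothesis.RiemannHypothesis.Theses

/-- F1-FREE detector (card §1 `bridge_gives_rh_above`): a bridge `C ⟹ DbnHighUniform` is a proof, from `C`, of RH
above height `3·10¹²`. [folklore] -/
theorem bridge_gives_rh_above (C : Prop) (hb : C → DBN.DbnHighUniform) (hC : C) :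
    ∀ s : ℂ, riemannZeta s = 0 → 3000000000000 < |s.im| → s.re = 1 / 2 :=
  fun _ hs him ↦ DbnTheory.re_eq_one_half_of_dbnHighUniform (hb hC) hs him

/-- Card `bridge_iff_rh_of_fin` (F1 as hypothesis). [folklore] -/
theorem bridge_iff_rh_of_fin (h₁ : platt_trudgian_numerical_rh) (C : Prop) :
    (C → DBN.DbnHighUniform) ↔ (C → _root_.RiemannHypothesis) :=
  ⟨fun h c ↦ DbnTheory.riemannHypothesis_of_dbnHighUniform h₁ (h c),
    fun h c ↦ DbnTheory.dbnHighUniform_of_riemannHypothesis (h c)⟩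

/-- Card `bridge_collapse` (F1 as hypothesis): for RH-implied `C`, a bridge IS `C ⟺ RH`. [folklore] -/
theorem bridge_collapse (h₁ : platt_trudgian_numerical_rh) (C : Prop) (hRC : _root_.RiemannHypothesis → C) :
    (C → DBN.DbnHighUniform) ↔ (C ↔ _root_.RiemannHypothesis) :=
  ⟨fun h ↦ ⟨fun c ↦ DbnTheory.riemannHypothesis_of_dbnHighUniform h₁ (h c), hRC⟩,
    fun h c ↦ DbnTheory.dbnHighUniform_of_riemannHypothesis (h.1 c)⟩

/-! ### the tetrachotomy's kernel facts, elaborated by name -/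

-- E_dbn and the route factorisation
example : DBN.DbnThesis ↔ _root_.RiemannHypothesis := dbnThesis_iff_riemannHypothesis
example : DBN.DbnThesis ↔ DBN.DbnHighUniform ∧ DBN.DbnLowAllT := dbnThesis_iff_dbnHighUniform_and_dbnLowAllT
-- (a) fixed t: the exponential reality threshold is a THEOREM
example {t : ℝ} (ht0 : 0 < t) (ht : t < 1 / 2) {z : ℂ} (hz : deBruijnH t z = 0)
    (hre : 4 * Real.pi * Real.exp (80 / t) ≤ |z.re|) : z.im = 0 :=
  DbnTheory.im_eq_zero_of_zero_of_exp_le_abs_re ht0 ht hz hre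
-- (b) uniform t → 0⁺ at bounded height = RH above that height (hyp-free) / RH-equivalent given F1
example (h : DBN.DbnHighUniform) {s : ℂ} (hs : riemannZeta s = 0) (him : 3000000000000 < |s.im|) :
    s.re = 1 / 2 := DbnTheory.re_eq_one_half_of_dbnHighUniform h hs him
example (h₁ : platt_trudgian_numerical_rh) : _root_.RiemannHypothesis ↔ DBN.DbnHighUniform :=
  DbnTheory.riemannHypothesis_iff_dbnHighUniform h₁
-- (c) t < 0 closed by a kernel theorem (Λ ≥ 0) and the barrier catalogue entry
example : ∀ t : ℝ, t < 0 → ¬ HasOnlyRealZeros (deBruijnH t) := rodgers_tao_holds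
example : Literature.Barriers.RiemannHypothesis.NewmanConjecture :=
  Literature.Barriers.RiemannHypothesis.NewmanConjecture_of_rodgers_tao rodgers_tao_holds
example : deBruijnNewmanConst_nonneg := deBruijnNewmanConst_nonneg_holds
-- C5: no coalescence ⟺ RH (hyp-free); cofinitely many zeros of each H_t simple is a theorem
example : DbnTheory.NoCoalescence ↔ _root_.RiemannHypothesis := DbnTheory.noCoalescence_iff_riemannHypothesis_holds
example : ki_kim_lee_cofinite_simple := ki_kim_lee_cofinite_simple_holds
-- R7: monotone t-splits degenerate
example : HasOnlyRealZeros.mono_deBruijnH := HasOnlyRealZeros.mono_deBruijnH_holds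

end DbnBridge

/-! ## §6b DBN-NEG — simplicity of the real zeros of `H_t` on the low window is RH (index-free; typed by rh-split-dbn-neg, re-typed by typer-2) -/

section DbnSimpleLow
open Literature.NumberTheory.LFunctions
open Summit.RiemannHypothesis.RiemannHypothesis.Theorems

/-- dbn, F1-free THEOREM (finite side of S3 at ε = 1/2): for every `t > 1/2` every real zero of `H_t` is simple
(de Bruijn `deBruijnNewmanConst_le_one_half` + Csordas–Smith–Varga `csordasSmithVarga_simple_zeros_holds`);
brief rh-split dbn. [folklore] -/
theorem deBruijnH_real_zeros_simple_of_half_lt {t : ℝ} (ht : 1 / 2 < t) {x : ℝ} (hx : deBruijnH t x = 0) :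
    deriv (deBruijnH t) x ≠ 0 := by
  have hreal : HasOnlyRealZeros (deBruijnH ((1 / 2 + t) / 2)) :=
    (deBruijnNewmanConst_le_iff_holds (1 / 2)).1 deBruijnNewmanConst_le_one_half _ (by linarith)
  exact csordasSmithVarga_simple_zeros_holds ((1 / 2 + t) / 2) t (by linarith) hreal x hx

/-- costume detector / RH-EQUIVALENT tail, F1-free, index-free (dbn-neg S3 at ε = 1/2): simplicity of the real
zeros of `H_t` on the LOW window `0 < t ≤ 1/2` gives RH (coalescence at `Λ`); brief rh-split dbn. [folklore] -/
theorem rh_of_simpleLow_half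
    (h : ∀ t : ℝ, 0 < t → t ≤ 1 / 2 → ∀ x : ℝ, deBruijnH t x = 0 → deriv (deBruijnH t) x ≠ 0) :
    _root_.RiemannHypothesis :=
  DbnTheory.riemannHypothesis_of_forall_pos_simple fun t ht x hx ↦ by
    rcases le_or_gt t (1 / 2) with hle | hlt
    · exact h t ht hle x hx
    · exact deBruijnH_real_zeros_simple_of_half_lt hlt hx

/-- costume detector, F1-free: the low-window simplicity statement IS RH (hypothesis-free iff); brief rh-split dbn.
[folklore] -/
theorem simpleLow_half_iff_rh :
    (∀ t : ℝ, 0 < t → t ≤ 1 / 2 → ∀ x : ℝ, deBruijnH t x = 0 → deriv (deBruijnH t) x ≠ 0) ↔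
      _root_.RiemannHypothesis :=
  ⟨rh_of_simpleLow_half,
    fun hRH t ht _ x hx ↦ (DbnTheory.riemannHypothesis_iff_forall_pos_simple.1 hRH) t ht x hx⟩

end DbnSimpleLow

/-! ## §7 X-TRANSFER — von Koch / Selberg-moment tails are RH by themselves (typed by rh-split-x-transfer, checked by typer-2) -/

section XTransfer
open Filter Literature.NumberTheory.LFunctions
open scoped Chebyshev Real
open Summit.RiemannHypothesis.RiemannHypothesis.Theorems

/-- S2 detector, std axioms: Schoenfeld's one-sided bound from some `x₀` on gives RH. [folklore] -/
theorem rh_of_kochTail {x₀ : ℝ}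
    (h : ∀ x : ℝ, x₀ ≤ x → ψ x - x ≤ √x * (Real.log x - 2) * Real.log x / (8 * π)) :
    _root_.RiemannHypothesis :=
  PfPersistenceDilatingLandau.riemannHypothesis_of_psi_le_schoenfeld (eventually_atTop.2 ⟨x₀, h⟩)

/-- S1 (Selberg transfer) glue re-typed: «no real zero in (0,1)» (theorem) ∧ «s(1−s) real at every strip zero» ⟹ RH.
[folklore] -/
theorem rh_of_selbergTail
    (hT : ∀ s : ℂ, riemannZeta s = 0 → 0 < s.re → s.re < 1 → (s * (1 - s)).im = 0) :
    _root_.RiemannHypothesis := by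
  intro s hs htriv h1
  -- strip membership
  have hre : 0 < s.re ∧ s.re < 1 := by
    refine ⟨?_, not_le.1 fun h ↦ riemannZeta_ne_zero_of_one_le_re h hs⟩
    by_contra hle
    obtain ⟨n, hn⟩ := (riemannZeta_eq_zero_iff_of_re_nonpos (not_lt.1 hle)).1 hs
    exact htriv ⟨n, hn⟩
  have him := hT s hs hre.1 hre.2
  -- Im (s(1-s)) = Im s · (1 − 2 Re s)
  have hcalc : (s * (1 - s)).im = s.im * (1 - 2 * s.re) := by
    simp [Complex.mul_im, Complex.sub_re, Complex.sub_im]; ring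
  rw [hcalc] at him
  rcases mul_eq_zero.1 him with h0 | h0
  · exact absurd hs (riemannZeta_ne_zero_of_im_eq_zero_of_pos_of_lt_one h0 hre.1 hre.2)
  · linarith

end XTransfer

end Summit.RiemannHypothesis.RiemannHypothesis.Theorems.Splittings.CostumeDetectorsHeight

end
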